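import Summits.BirchSwinnertonDyer.BirchSwinnertonDyer.Theorems.AdditiveKolyvaginRoadKolyvaginIsoBoundCore
import Summits.BirchSwinnertonDyer.BirchSwinnertonDyer.Theorems.KolyvaginRoadThreeMethod2KolyvaginIsoBoundLocal
import Summits.BirchSwinnertonDyer.BirchSwinnertonDyer.Theorems.KolyvaginRoadThreeMethod2KolyvaginLine
import HarnessLib

/-!
# Route `AdditiveKolyvaginRoad`, crux `KolyvaginPrimitiveAdditive` (item stmt-BirchSwinnertonDyer-20132):
# stub LOC, towards (Supply) at a general odd prime `p` — A RAMIFIED EIGEN-COCYCLE WITH ISOTROPIC SELF-CUP-PRODUCT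
# IS UNRAMIFIED-TRIVIAL (second layer of the port of zhang3-p1's (IsoBound))
# (cell `pub/bsd-wall`, lead prover `bsd-wall-akr-p1` g3; `--supports stmt-BirchSwinnertonDyer-20132`, helper;
# p-generic port of zhang3-p1's `Theorems/KolyvaginRoadThreeMethod2KolyvaginIsoBoundLocal.lean`, `3 ↦ p¹`)

WHY THIS FILE. See `…AdditiveKolyvaginRoadKolyvaginIsoBoundCore`: (IsoBound) is the one local input of (Supply) for
stub LOC of crux 20132. This is its second layer at a general odd prime `p = 2k + 1`.

WHAT CHANGES AT GENERAL `p`. zhang3-p1's `ν`-eigen-projection `a ↦ 2 (a + ν t a)` used `4 ≡ 1 (mod 3)`; here it is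
`a ↦ u (a + ν t a)` with `2u ≡ 1 (mod p)` (`exists_two_mul_zsmul_eq_of_odd`). zhang3-p1's symmetric combination
`[f ∪ f] + [u ∪ w]` used `-2 ≡ 1 (mod 3)`; at `p = 2k + 1` the symmetric combination is `k [f ∪ f] + [u ∪ w]`:
with `a = a⁺ + a⁻` along the two isotropic projections, `e(a, b) = e(a⁺, b⁻) + e(a⁻, b⁺)` and `(u ∪ w) ↦ e(a⁺, b⁻)`, so
`k e(a, b) + e(a⁺, b⁻) = (k + 1) e(a⁺, b⁻) + k e(a⁻, b⁺)` whose antisymmetrisation is `(2k + 1)(…) = p (…) = 0`. A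
symmetric bi-additive `2`-cocycle of odd exponent is a coboundary (`twoCocycleClass_eq_zero_of_symmetric_odd`), so
`[f ∪ f] = 0 ⟹ [u ∪ w] = 0`, contradicting the local (Perf) core exactly as at `p = 3`.

WHAT. §0 the projection algebra with `2u ≡ 1`; §1 `twoCocycleClass_cupCocycle_add_eq_zero_of_proj_P`
(`k [f ∪ₑ f] + [u ∪ₑ w] = 0`); §2 `apply_frob_eq_zero_of_self_cup_eq_zero_P` (zhang3-p1's statement with `3 ↦ p`,
`p` odd, surjective mod-`p` image).

HONEST FRAMING: theorems only; 0 definitions, 0 named facts, 0 `sorry`; closes nothing.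

References: [cite: WZhang2014, Lemma 8.4 (1)] [cite: GrossLMS1991, Prop. 8.1] [cite: MazurRubin2004, Prop. 1.3.2 (proof)].
-/

-- single-conjunct summit: `Summit.BirchSwinnertonDyer.BirchSwinnertonDyer.…` repeats the name by design
set_option linter.dupNamespace false

noncomputable section

open scoped Classical Pointwise

namespace Summit.BirchSwinnertonDyer.BirchSwinnertonDyer.Theorems.AdditiveKoly

open CategoryTheory WeierstrassCurve Field Function NumberField IsDedekindDomain
open Literature.NumberTheory.EllipticCurves Literature.NumberTheory.EllipticCurves.ModularForms
  Literature.NumberTheory.GaloisRepresentations Module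
open Literature.NumberTheory.GaloisRepresentations.DiscreteGaloisModule (mu MuCarrier tateDual tateDualEval TateDual)
open Literature.NumberTheory.GaloisCohomology
open Summit.BirchSwinnertonDyer.Rank1Residual.X11b.Three.Koly.Method2
open Summit.BirchSwinnertonDyer.Rank1Residual.GaloisImage
open Summit.BirchSwinnertonDyer.Rank1Residual.JET Summit.BirchSwinnertonDyer.Rank1Residual.X11b
open scoped ContRepresentation

/-! ## §0 Eigen-projection algebra for an involution of a group on which `2` is invertible -/

section Projection

variable {A : Type*} [AddCommGroup A] (t : A →+ A)

/-- The `ν`-eigen-projection `a ↦ u (a + ν t a)` (`2u ≡ 1`) fixes `ν`-eigenvectors. [folklore] -/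
theorem proj_eq_self_of_eigen_P {u : ℤ} (h2u : ∀ a : A, (2 * u) • a = a) {ν : ℤ} (hν : ν = 1 ∨ ν = -1) {a : A}
    (ha : t a = ν • a) : u • (a + ν • t a) = a := by
  rw [ha, smul_smul]
  have h := h2u a
  rcases hν with rfl | rfl
  · simp only [mul_one, one_smul]
    linear_combination (norm := module) h
  · simp only [mul_neg, mul_one, neg_neg, one_smul]
    linear_combination (norm := module) h

/-- The `ν`-eigen-projection kills `(-ν)`-eigenvectors. [folklore] -/
theorem proj_eq_zero_of_eigen_neg_P {ν : ℤ} (hν : ν = 1 ∨ ν = -1) (u : ℤ) {a : A} (ha : t a = -(ν • a)) :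
    u • (a + ν • t a) = 0 := by
  rw [ha, smul_neg, smul_smul]
  rcases hν with rfl | rfl
  · simp only [mul_one, one_smul, add_neg_cancel, smul_zero]
  · simp only [mul_neg, mul_one, neg_neg, one_smul, add_neg_cancel, smul_zero]

/-- The `ν`-eigen-projection takes values in the `ν`-eigenspace (`t² = 1`). [folklore] -/
theorem apply_proj_eq_P (htt : ∀ a, t (t a) = a) {ν : ℤ} (hν : ν = 1 ∨ ν = -1) (u : ℤ) (a : A) :
    t (u • (a + ν • t a)) = ν • (u • (a + ν • t a)) := by
  rw [map_zsmul, map_add, map_zsmul, htt]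
  rcases hν with rfl | rfl <;> module

/-- The complementary projection `a - pr_ν a` takes values in the `(-ν)`-eigenspace (`t² = 1`, `2u ≡ 1`). [folklore] -/
theorem apply_sub_proj_eq_P (htt : ∀ a, t (t a) = a) {u : ℤ} (h2u : ∀ a : A, (2 * u) • a = a) {ν : ℤ}
    (hν : ν = 1 ∨ ν = -1) (a : A) :
    t (a - u • (a + ν • t a)) = -(ν • (a - u • (a + ν • t a))) := by
  have h1 := h2u (t a)
  have h2 := h2u a
  rw [map_sub, map_zsmul, map_add, map_zsmul, htt]
  rcases hν with rfl | rfl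
  · linear_combination (norm := module) -h1 - h2
  · linear_combination (norm := module) -h1 + h2

end Projection

variable (W : WeierstrassCurve ℚ) (K : Type) [Field K] [NumberField K] (p : ℕ) [W.IsElliptic] [W.IsGloballyMinimal]
  [Fact p.Prime] [∀ v : Place K, CompactSpace (absoluteGaloisGroup (Place.Completion v))]
  [Finite (geomTorsion (W.baseChange K) ((p ^ 1 : ℕ) : ℤ))]

/-! ## §1 The symmetric part of `f ∪ f` for an eigen-decomposition `f = u + w` (`p = 2k + 1`) -/

omit [W.IsElliptic] [W.IsGloballyMinimal] [Finite (geomTorsion (W.baseChange K) ((p ^ 1 : ℕ) : ℤ))] in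
/-- **`k [f ∪ₑ f] + [u ∪ₑ w] = 0` for a decomposition `f = u + w` along complementary isotropic projections**
(`p = 2k + 1`). Local, at a finite place `v` where `Γ_{K_v}` fixes `E[p]` and `μ_p` (hypotheses `hfixA`, `hfixμ`): for
an additive `pr : E[p] → E[p]` with `e(pr a, pr b) = 1 = e(a - pr a, b - pr b)` and local cocycles `f, u, w` with
`u = pr ∘ f`, `w = f - u` pointwise, the `2`-cocycle `k (f ∪ₑ f) + u ∪ₑ w` is `(σ, τ) ↦ B(f σ, f τ)` with
`B(a, b) = k e(a, b) + e(pr a, b)`, bi-additive and symmetric (its antisymmetrisation is `(2k + 1) (…) = 0`), hence a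
coboundary (`twoCocycleClass_eq_zero_of_symmetric_odd`). [cite: MazurRubin2004, Prop. 1.3.2 (proof)]
[cite: WZhang2014, Lemma 8.4 (1)] -/
theorem twoCocycleClass_cupCocycle_add_eq_zero_of_proj_P
    (e : geomTorsion (W.baseChange K) ((p ^ 1 : ℕ) : ℤ) → geomTorsion (W.baseChange K) ((p ^ 1 : ℕ) : ℤ) →
      AlgebraicClosure K)
    (hμ : ∀ P Q, e P Q ^ (p ^ 1) = 1) (hadd₁ : ∀ P₁ P₂ Q, e (P₁ + P₂) Q = e P₁ Q * e P₂ Q)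
    (hadd₂ : ∀ P Q₁ Q₂, e P (Q₁ + Q₂) = e P Q₁ * e P Q₂) (halt : ∀ Q, e Q Q = 1)
    (hgal : ∀ (σ : absoluteGaloisGroup K) (P Q : geomTorsion (W.baseChange K) ((p ^ 1 : ℕ) : ℤ)),
      σ • e P Q = e (σ • P) (σ • Q))
    (v : HeightOneSpectrum (𝓞 K))
    (hfixA : ∀ (g : absoluteGaloisGroup (v.adicCompletion K)) (Q : geomTorsion (W.baseChange K) ((p ^ 1 : ℕ) : ℤ)),
      absGaloisRestrict K (v.adicCompletion K) g • Q = Q)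
    (hfixμ : ∀ (g : absoluteGaloisGroup (v.adicCompletion K)) (z : MuCarrier K (p ^ 1)),
      mu K (p ^ 1) (absGaloisRestrict K (v.adicCompletion K) g) z = z)
    (k : ℕ) (hpk : ∀ z : MuCarrier K (p ^ 1), (2 * k + 1) • z = 0)
    (pr : geomTorsion (W.baseChange K) ((p ^ 1 : ℕ) : ℤ) →+ geomTorsion (W.baseChange K) ((p ^ 1 : ℕ) : ℤ))
    (hprpr : ∀ a b, weilPairingHom (W.baseChange K) (p ^ 1) e hμ hadd₁ hadd₂ (pr a) (pr b) = 0)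
    (hsubsub : ∀ a b, weilPairingHom (W.baseChange K) (p ^ 1) e hμ hadd₁ hadd₂ (a - pr a) (b - pr b) = 0)
    (f u w : contOneCocycles (DiscreteGaloisModule.toLocal ((W.baseChange K).torsionGaloisModule ((p ^ 1 : ℕ) : ℤ))
      (Sum.inr v)).toTopRep)
    (hu : ∀ g, u.1 g = pr (f.1 g)) (hw : ∀ g, w.1 g = f.1 g - pr (f.1 g)) :
    k • twoCocycleClass _
        ((weilContPairingLocal (W.baseChange K) (p ^ 1) e hμ hadd₁ hadd₂ hgal (Sum.inr v)).cupCocycle f f) +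
      twoCocycleClass _
        ((weilContPairingLocal (W.baseChange K) (p ^ 1) e hμ hadd₁ hadd₂ hgal (Sum.inr v)).cupCocycle u w) = 0 := by
  have hf_add : ∀ g g', f.1 (g * g') = f.1 g + f.1 g' := fun g g' ↦
    (f.2 g g').trans (congrArg (fun Q ↦ f.1 g + Q) (hfixA g (f.1 g')))
  obtain ⟨W₀, hW₀⟩ : ∃ W₀, W₀ = weilPairingHom (W.baseChange K) (p ^ 1) e hμ hadd₁ hadd₂ := ⟨_, rfl⟩
  have hW₀self : ∀ a, W₀ a a = 0 := fun a ↦ by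
    rw [hW₀]; exact weilPairingHom_self (W.baseChange K) (p ^ 1) e hμ hadd₁ hadd₂ halt a
  have hW₀anti : ∀ a b, W₀ b a = -W₀ a b := fun a b ↦ KolyvaginReciprocity.pairing_antisymm W₀ hW₀self a b
  rw [← hW₀] at hprpr hsubsub
  -- ### `W₀ a b` through the decomposition `a = pr a + (a - pr a)`
  have hkey : ∀ a b, W₀ a b = W₀ (pr a) (b - pr b) + W₀ (a - pr a) (pr b) := fun a b ↦ by
    calc W₀ a b = W₀ (pr a + (a - pr a)) (pr b + (b - pr b)) := by rw [add_sub_cancel, add_sub_cancel]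
      _ = W₀ (pr a) (pr b) + W₀ (pr a) (b - pr b) + (W₀ (a - pr a) (pr b) + W₀ (a - pr a) (b - pr b)) := by
        simp only [map_add, AddMonoidHom.add_apply]; abel
      _ = W₀ (pr a) (b - pr b) + W₀ (a - pr a) (pr b) := by rw [hprpr a b, hsubsub a b, zero_add, add_zero]
  have hX : ∀ a b, W₀ (pr a) (b - pr b) = W₀ (pr a) b := fun a b ↦ by
    rw [map_sub (W₀ (pr a)) b (pr b), hprpr a b, sub_zero]
  have hY : ∀ a b, W₀ (a - pr a) (pr b) = -W₀ (pr b) a := fun a b ↦ by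
    rw [hW₀anti (pr b) (a - pr a), map_sub (W₀ (pr b)) a (pr a), hprpr b a, sub_zero]
  have hkey₂ : ∀ a b, W₀ a b = W₀ (pr a) b + -W₀ (pr b) a := fun a b ↦
    (hkey a b).trans (congrArg₂ (· + ·) (hX a b) (hY a b))
  have hpk' : ∀ z : MuCarrier K (p ^ 1), (2 * (k : ℤ) + 1) • z = 0 := fun z ↦ by
    have h := hpk z
    rw [← natCast_zsmul] at h
    push_cast at h
    exact h
  -- ### the symmetric bi-additive form `B(a, b) = k e(a, b) + e(pr a, b)`
  have hBsymm : ∀ a b, (k : ℤ) • W₀ a b + W₀ (pr a) b = (k : ℤ) • W₀ b a + W₀ (pr b) a := by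
    intro a b
    have h1 := hkey₂ a b
    have h2 := hkey₂ b a
    have h3 := hpk' (W₀ (pr a) b)
    have h4 := hpk' (W₀ (pr b) a)
    linear_combination (norm := module) (k : ℤ) • h1 - (k : ℤ) • h2 + h3 - h4
  -- ### the cocycle values
  have h1 : ∀ σ τ, ((weilContPairingLocal (W.baseChange K) (p ^ 1) e hμ hadd₁ hadd₂ hgal (Sum.inr v)).cupCocycle f
      f).1 (σ, τ) = W₀ (f.1 σ) (f.1 τ) := fun σ τ ↦ by
    rw [ContPairing.cupCocycle_apply_eq_smul, weilContPairingLocal_toLin_apply, hW₀]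
    exact congrArg (fun Q ↦ weilPairingHom (W.baseChange K) (p ^ 1) e hμ hadd₁ hadd₂ (f.1 σ) Q) (hfixA σ (f.1 τ))
  have h2 : ∀ σ τ, ((weilContPairingLocal (W.baseChange K) (p ^ 1) e hμ hadd₁ hadd₂ hgal (Sum.inr v)).cupCocycle u
      w).1 (σ, τ) = W₀ (pr (f.1 σ)) (f.1 τ - pr (f.1 τ)) := fun σ τ ↦ by
    rw [ContPairing.cupCocycle_apply_eq_smul, weilContPairingLocal_toLin_apply, hW₀, hu, ← hw τ]
    exact congrArg (fun Q ↦ weilPairingHom (W.baseChange K) (p ^ 1) e hμ hadd₁ hadd₂ (pr (f.1 σ)) Q) (hfixA σ (w.1 τ))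
  have hc : ∀ σ τ, (k • (weilContPairingLocal (W.baseChange K) (p ^ 1) e hμ hadd₁ hadd₂ hgal (Sum.inr v)).cupCocycle f f +
      (weilContPairingLocal (W.baseChange K) (p ^ 1) e hμ hadd₁ hadd₂ hgal (Sum.inr v)).cupCocycle u w).1 (σ, τ) =
        (k : ℤ) • W₀ (f.1 σ) (f.1 τ) + W₀ (pr (f.1 σ)) (f.1 τ) := by
    intro σ τ
    calc _ = k • ((weilContPairingLocal (W.baseChange K) (p ^ 1) e hμ hadd₁ hadd₂ hgal (Sum.inr v)).cupCocycle f f).1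
          (σ, τ) + ((weilContPairingLocal (W.baseChange K) (p ^ 1) e hμ hadd₁ hadd₂ hgal (Sum.inr v)).cupCocycle u
            w).1 (σ, τ) := rfl
      _ = k • W₀ (f.1 σ) (f.1 τ) + W₀ (pr (f.1 σ)) (f.1 τ - pr (f.1 τ)) := congrArg₂ (· + ·) (congrArg (k • ·) (h1 σ τ)) (h2 σ τ)
      _ = _ := by rw [hX, natCast_zsmul]
  have hcl : twoCocycleClass _ (k • (weilContPairingLocal (W.baseChange K) (p ^ 1) e hμ hadd₁ hadd₂ hgal (Sum.inr v)).cupCocycle f f +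
      (weilContPairingLocal (W.baseChange K) (p ^ 1) e hμ hadd₁ hadd₂ hgal (Sum.inr v)).cupCocycle u w) =
      k • twoCocycleClass _
        ((weilContPairingLocal (W.baseChange K) (p ^ 1) e hμ hadd₁ hadd₂ hgal (Sum.inr v)).cupCocycle f f) +
      twoCocycleClass _
        ((weilContPairingLocal (W.baseChange K) (p ^ 1) e hμ hadd₁ hadd₂ hgal (Sum.inr v)).cupCocycle u w) := by
    have hns : twoCocycleClass _
        (k • (weilContPairingLocal (W.baseChange K) (p ^ 1) e hμ hadd₁ hadd₂ hgal (Sum.inr v)).cupCocycle f f) =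
        k • twoCocycleClass _
          ((weilContPairingLocal (W.baseChange K) (p ^ 1) e hμ hadd₁ hadd₂ hgal (Sum.inr v)).cupCocycle f f) :=
      map_nsmul (twoCocycleClassₗ (DiscreteGaloisModule.toLocal (mu K (p ^ 1)) (Sum.inr v)).toTopRep) k
        ((weilContPairingLocal (W.baseChange K) (p ^ 1) e hμ hadd₁ hadd₂ hgal (Sum.inr v)).cupCocycle f f)
    rw [twoCocycleClass_add, hns]
  rw [← hcl]
  exact twoCocycleClass_eq_zero_of_symmetric_odd _ f.1 hf_add (fun a b ↦ (k : ℤ) • W₀ a b + W₀ (pr a) b)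
    (fun a a' b ↦ by simp only [map_add, AddMonoidHom.add_apply, smul_add]; abel)
    (fun a b b' ↦ by simp only [map_add, smul_add]; abel)
    (fun σ τ ↦ hBsymm _ _) k (fun σ τ ↦ hpk _) (fun g σ τ ↦ hfixμ g _) _ hc

/-! ## §2 A ramified eigen-cocycle with isotropic self-cup-product has Frobenius value `0` -/

/-- **A ramified eigen-cocycle with isotropic self-cup-product has Frobenius value `0`.** Local, at a Kolyvagin prime
`λ ∋ ℓ` of the HL frame (so `Γ_λ` fixes `E[p]` and `μ_p`): `fx : Γ_{K_λ} → E[p]` a continuous cocycle whose value at a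
lift `g_F` of an arithmetic Frobenius `F` at `𝔓 ∣ λ` is a `ν`-eigenvector of the involution `tM` and whose values above
`I_𝔓` are `(-ν)`-eigenvectors, with a non-zero inertia value, and `[fx ∪ₑ fx] = 0` in `H²(K_λ, μ_p)`. Then `fx(g_F) = 0`.
See the module docstring for the proof (`fx = u + w`, `k [fx ∪ fx] = -[u ∪ w] ≠ 0`, `p = 2k + 1`).
[cite: WZhang2014, Lemma 8.4 (1)] [cite: GrossLMS1991, Prop. 8.1] [cite: MazurRubin2004, Prop. 1.3.2 (proof)] -/
theorem apply_frob_eq_zero_of_self_cup_eq_zero_P (hK : IsImaginaryQuadratic K) (hp2 : p ≠ 2)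
    (hsurj : W.HasSurjectiveModNGaloisRep p)
    (e : geomTorsion (W.baseChange K) ((p ^ 1 : ℕ) : ℤ) → geomTorsion (W.baseChange K) ((p ^ 1 : ℕ) : ℤ) →
      AlgebraicClosure K)
    (hμ : ∀ P Q, e P Q ^ (p ^ 1) = 1) (hadd₁ : ∀ P₁ P₂ Q, e (P₁ + P₂) Q = e P₁ Q * e P₂ Q)
    (hadd₂ : ∀ P Q₁ Q₂, e P (Q₁ + Q₂) = e P Q₁ * e P Q₂) (halt : ∀ Q, e Q Q = 1)
    (hnondeg : ∀ Q, (∀ P, e P Q = 1) → Q = 0)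
    (hgal : ∀ (σ : absoluteGaloisGroup K) (P Q : geomTorsion (W.baseChange K) ((p ^ 1 : ℕ) : ℤ)),
      σ • e P Q = e (σ • P) (σ • Q))
    {ℓ : ℕ} (hℓ : Zhang2014.IsKolyvaginPrime (W.conductorNorm ℤ) W K p ℓ) (v : HeightOneSpectrum (𝓞 K))
    (hv : (ℓ : 𝓞 K) ∈ v.asIdeal) {𝔐 : Ideal (HeightOneSpectrum.localAbsIntegers v)} (h𝔐 : 𝔐 ∈ v.localPrimesAbove)
    {F : absoluteGaloisGroup K} (hF : IsArithFrobAt (𝓞 K) F (v.primeBelow (closureEmb (K := K) (v.adicCompletion K)) 𝔐))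
    {gF : absoluteGaloisGroup (v.adicCompletion K)} (hgF : absGaloisRestrict K (v.adicCompletion K) gF = F)
    (tM : geomTorsion (W.baseChange K) ((p ^ 1 : ℕ) : ℤ) →+ geomTorsion (W.baseChange K) ((p ^ 1 : ℕ) : ℤ))
    (htt : ∀ a, tM (tM a) = a) {ν : ℤ} (hν : ν = 1 ∨ ν = -1)
    (fx : contOneCocycles (DiscreteGaloisModule.toLocal ((W.baseChange K).torsionGaloisModule ((p ^ 1 : ℕ) : ℤ))
      (Sum.inr v)).toTopRep)
    (hPν : tM (fx.1 gF) = ν • fx.1 gF)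
    (hIν : ∀ g, absGaloisRestrict K (v.adicCompletion K) g ∈
      (v.primeBelow (closureEmb (K := K) (v.adicCompletion K)) 𝔐).inertia (absoluteGaloisGroup K) →
      tM (fx.1 g) = -(ν • fx.1 g))
    (hram : ∃ g, absGaloisRestrict K (v.adicCompletion K) g ∈
      (v.primeBelow (closureEmb (K := K) (v.adicCompletion K)) 𝔐).inertia (absoluteGaloisGroup K) ∧ fx.1 g ≠ 0)
    (hxx : twoCocycleClass _
      ((weilContPairingLocal (W.baseChange K) (p ^ 1) e hμ hadd₁ hadd₂ hgal (Sum.inr v)).cupCocycle fx fx) = 0) :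
    fx.1 gF = 0 := by
  classical
  by_contra hP0
  have hp : p.Prime := Fact.out
  have hp1 : Nat.Prime (p ^ 1) := by rw [pow_one]; exact hp
  have hp12 : p ^ 1 ≠ 2 := by rw [pow_one]; exact hp2
  obtain ⟨k, hk⟩ : ∃ k, p = 2 * k + 1 := hp.odd_of_ne_two hp2
  have hk1 : 1 ≤ Zhang2014.kolyvaginIndex W p ℓ := hℓ.2.2.2.2.2
  haveI : NeZero (p ^ 1 : ℕ) := ⟨pow_ne_zero 1 hp.ne_zero⟩
  -- ### `Γ_λ` fixes `E[p]` and `μ_p`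
  have hℓG := isKolyvaginPrime_pow_one_of_zhang W K p hK hp2 hsurj hℓ
  have h𝔓 : v.primeBelow (closureEmb (K := K) (v.adicCompletion K)) 𝔐 ∈ v.primesAbove :=
    HeightOneSpectrum.primeBelow_mem_primesAbove h𝔐
  haveI := h𝔓.1
  have hD : ∀ d ∈ (v.primeBelow (closureEmb (K := K) (v.adicCompletion K)) 𝔐).decompositionSubgroup (absoluteGaloisGroup K),
      d ∈ torsionFixing (W.baseChange K) ((p ^ 1 : ℕ) : ℤ) := fun d hd ↦
    GlobalDuality.decompositionSubgroup_le_torsionFixing W K hK hℓ hk1 v hv h𝔓 hd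
  have hres : ∀ g : absoluteGaloisGroup (v.adicCompletion K), absGaloisRestrict K (v.adicCompletion K) g ∈
      (v.primeBelow (closureEmb (K := K) (v.adicCompletion K)) 𝔐).decompositionSubgroup (absoluteGaloisGroup K) :=
    fun g ↦ by
    rw [← resGal_eq_absGaloisRestrict, resGal_eq]; exact resGalOfEmb_mem_decompositionSubgroup _ h𝔐 g
  have hfixA : ∀ (g : absoluteGaloisGroup (v.adicCompletion K)) (Q : geomTorsion (W.baseChange K) ((p ^ 1 : ℕ) : ℤ)),
      absGaloisRestrict K (v.adicCompletion K) g • Q = Q := fun g Q ↦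
    smul_eq_of_mem_torsionFixing (W.baseChange K) _ (hD _ (hres g)) Q
  have hfixμ : ∀ (g : absoluteGaloisGroup (v.adicCompletion K)) (z : MuCarrier K (p ^ 1)),
      mu K (p ^ 1) (absGaloisRestrict K (v.adicCompletion K) g) z = z := by
    intro g z
    apply MuCarrier.toAdditive.injective
    rw [DiscreteGaloisModule.mu_apply_apply]
    apply Additive.toMul.injective
    rw [toMul_ofMul]
    apply Subtype.ext
    apply Units.ext
    rw [absoluteGaloisGroup.coe_smul_rootsOfUnity, Units.coe_smul]
    have hz : ((((MuCarrier.toAdditive z).toMul : rootsOfUnity (p ^ 1) (AlgebraicClosure K)) : (AlgebraicClosure K)ˣ) :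
        AlgebraicClosure K) ^ p = 1 := by
      have h1 := ((MuCarrier.toAdditive z).toMul).2
      rw [mem_rootsOfUnity] at h1
      have h1' : ((MuCarrier.toAdditive z).toMul : rootsOfUnity (p ^ 1) (AlgebraicClosure K)).1 ^ p = 1 :=
        (congrArg (fun k : ℕ ↦ ((MuCarrier.toAdditive z).toMul : rootsOfUnity (p ^ 1) (AlgebraicClosure K)).1 ^ k)
          (pow_one p)).symm.trans h1
      rw [← Units.val_pow_eq_pow_val, h1', Units.val_one]
    exact smul_eq_self_of_pow_eq_one_of_mem_torsionFixing_P W K p e hμ hnondeg hgal (hD _ (hres g)) hz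
  have hpT : ∀ Q : geomTorsion (W.baseChange K) ((p ^ 1 : ℕ) : ℤ), (p ^ 1) • Q = 0 := fun Q ↦ by
    have := (mem_geomTorsion_iff (W.baseChange K) ((p ^ 1 : ℕ) : ℤ) _).mp Q.2
    apply Subtype.ext
    rw [AddSubgroupClass.coe_nsmul, ← natCast_zsmul]
    exact this
  have hμ3 : ∀ z : MuCarrier K (p ^ 1), p • z = 0 := fun z ↦ by
    rw [← show (p ^ 1) • z = p • z from congrArg (fun k : ℕ ↦ k • z) (pow_one p), ← natCast_zsmul]
    exact zsmul_muCarrier_eq_zero K (p ^ 1) z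
  have hcard : Nat.card (geomTorsion (W.baseChange K) ((p ^ 1 : ℕ) : ℤ)) = (p ^ 1) ^ 2 :=
    card_torsionPoints_eq_sq_holds (W.baseChange K) (AlgebraicClosure K) (n := p ^ 1) (by exact_mod_cast hp1.ne_zero)
  -- `2` is invertible on `E[p]`: `(2u) a = a`
  obtain ⟨uu, h2u⟩ : ∃ uu : ℤ, ∀ P : geomTorsion (W.baseChange K) ((p ^ 1 : ℕ) : ℤ), (2 * uu) • P = P :=
    exists_two_mul_zsmul_eq_of_odd (W.baseChange K) (n := p ^ 1) (by rw [pow_one]; exact hp.odd_of_ne_two hp2)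
  have hfx_add : ∀ g g', fx.1 (g * g') = fx.1 g + fx.1 g' := fun g g' ↦
    (fx.2 g g').trans (congrArg (fun Q ↦ fx.1 g + Q) (hfixA g (fx.1 g')))
  obtain ⟨W₀, hW₀⟩ : ∃ W₀, W₀ = weilPairingHom (W.baseChange K) (p ^ 1) e hμ hadd₁ hadd₂ := ⟨_, rfl⟩
  have hW₀self : ∀ a, W₀ a a = 0 := fun a ↦ by
    rw [hW₀]; exact weilPairingHom_self (W.baseChange K) (p ^ 1) e hμ hadd₁ hadd₂ halt a
  have hW₀line : ∀ {R a b : geomTorsion (W.baseChange K) ((p ^ 1 : ℕ) : ℤ)}, a ∈ AddSubgroup.zmultiples R →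
      b ∈ AddSubgroup.zmultiples R → W₀ a b = 0 := by
    intro R a b ha hb
    obtain ⟨k, rfl⟩ := AddSubgroup.mem_zmultiples_iff.mp ha
    obtain ⟨k', rfl⟩ := AddSubgroup.mem_zmultiples_iff.mp hb
    rw [map_zsmul (W₀ (k • R)) k' R, show W₀ (k • R) R = W₀.flip R (k • R) from rfl, map_zsmul, AddMonoidHom.flip_apply,
      hW₀self, smul_zero, smul_zero]
  -- ### the ramified value `Q = fx g₀`; the two eigen-lines `ℤ P`, `ℤ Q` (`P = fx g_F`)
  obtain ⟨g₀, hg₀I, hQ0⟩ := hram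
  have hQν : tM (fx.1 g₀) = -(ν • fx.1 g₀) := hIν g₀ hg₀I
  have hePQ : e (fx.1 gF) (fx.1 g₀) ≠ 1 :=
    weil_ne_one_of_eigen_P W K p hp2 e hμ hadd₁ hadd₂ halt hnondeg tM hν hPν hP0 hQν hQ0
  have hWPQ : W₀ (fx.1 gF) (fx.1 g₀) ≠ 0 := fun h0 ↦
    hePQ (by rw [hW₀, muCarrier_eq_iff, coe_weilPairingHom] at h0; exact h0)
  have hν' : -ν = 1 ∨ -ν = -1 := by rcases hν with rfl | rfl <;> simp
  have hEp : ∀ a, tM a = ν • a → a ∈ AddSubgroup.zmultiples (fx.1 gF) := fun a ha ↦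
    KolyLocal.mem_zmultiples_of_eigen_of_eigen hp1 hp12 hcard hpT tM hν hP0 hPν hQ0 hQν ha
  have hEm : ∀ a, tM a = -(ν • a) → a ∈ AddSubgroup.zmultiples (fx.1 g₀) := fun a ha ↦
    KolyLocal.mem_zmultiples_of_eigen_of_eigen hp1 hp12 hcard hpT tM hν' hQ0 (by rw [neg_smul]; exact hQν) hP0
      (by rw [neg_smul, neg_neg]; exact hPν) (by rw [neg_smul]; exact ha)
  -- ### the `ν`-eigen-projection `pr` and the cocycles `u = pr ∘ fx` (unramified), `w = fx - u`
  obtain ⟨pr, hpr⟩ : ∃ pr : geomTorsion (W.baseChange K) ((p ^ 1 : ℕ) : ℤ) →+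
      geomTorsion (W.baseChange K) ((p ^ 1 : ℕ) : ℤ), ∀ a, pr a = uu • (a + ν • tM a) :=
    ⟨AddMonoidHom.mk' (fun a ↦ uu • (a + ν • tM a)) fun a b ↦ by
      rw [map_add, smul_add ν, add_add_add_comm, smul_add], fun _ ↦ rfl⟩
  have hpr_line : ∀ a, pr a ∈ AddSubgroup.zmultiples (fx.1 gF) := fun a ↦
    hEp _ (by rw [hpr]; exact apply_proj_eq_P tM htt hν uu a)
  have hsub_line : ∀ a, a - pr a ∈ AddSubgroup.zmultiples (fx.1 g₀) := fun a ↦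
    hEm _ (by rw [hpr]; exact apply_sub_proj_eq_P tM htt h2u hν a)
  have hprP : pr (fx.1 gF) = fx.1 gF := by rw [hpr]; exact proj_eq_self_of_eigen_P tM h2u hν hPν
  have hprI : ∀ g, absGaloisRestrict K (v.adicCompletion K) g ∈
      (v.primeBelow (closureEmb (K := K) (v.adicCompletion K)) 𝔐).inertia (absoluteGaloisGroup K) → pr (fx.1 g) = 0 :=
    fun g hg ↦ by rw [hpr]; exact proj_eq_zero_of_eigen_neg_P tM hν uu (hIν g hg)
  obtain ⟨u, hudef⟩ : ∃ u : contOneCocycles (DiscreteGaloisModule.toLocal ((W.baseChange K).torsionGaloisModule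
      ((p ^ 1 : ℕ) : ℤ)) (Sum.inr v)).toTopRep,
      u = ⟨(⟨pr, continuous_of_discreteTopology⟩ : C(geomTorsion (W.baseChange K) ((p ^ 1 : ℕ) : ℤ),
        geomTorsion (W.baseChange K) ((p ^ 1 : ℕ) : ℤ))).comp fx.1, (mem_contOneCocycles_iff _).mpr fun g h ↦ by
          rw [ContinuousMap.comp_apply, ContinuousMap.comp_apply, ContinuousMap.comp_apply, ContinuousMap.coe_mk,
            hfx_add, map_add]
          exact congrArg (fun Q ↦ pr (fx.1 g) + Q) (hfixA g (pr (fx.1 h))).symm⟩ := ⟨_, rfl⟩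
  have hu : ∀ g, u.1 g = pr (fx.1 g) := fun g ↦ by rw [hudef]; rfl
  obtain ⟨w, hwdef⟩ : ∃ w : contOneCocycles (DiscreteGaloisModule.toLocal ((W.baseChange K).torsionGaloisModule
      ((p ^ 1 : ℕ) : ℤ)) (Sum.inr v)).toTopRep, w = fx - u := ⟨_, rfl⟩
  have hw : ∀ g, w.1 g = fx.1 g - pr (fx.1 g) := fun g ↦ by
    rw [hwdef, Submodule.coe_sub, ContinuousMap.sub_apply, hu]
  have huF : u.1 gF = fx.1 gF := (hu gF).trans hprP
  have huI : ∀ g, absGaloisRestrict K (v.adicCompletion K) g ∈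
      (v.primeBelow (closureEmb (K := K) (v.adicCompletion K)) 𝔐).inertia (absoluteGaloisGroup K) → u.1 g = 0 :=
    fun g hg ↦ (hu g).trans (hprI g hg)
  have hwg₀ : w.1 g₀ = fx.1 g₀ := by rw [hw, hprI g₀ hg₀I, sub_zero]
  -- ### `[u ∪ w] ≠ 0` (the local (Perf) core)
  have huw : twoCocycleClass _
      ((weilContPairingLocal (W.baseChange K) (p ^ 1) e hμ hadd₁ hadd₂ hgal (Sum.inr v)).cupCocycle u w) ≠ 0 :=
    twoCocycleClass_weilCupCocycle_ne_zero_P W K p hK hp2 hsurj e hμ hadd₁ hadd₂ hnondeg hgal hℓ v hv h𝔐 hF hgF u w huI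
      (by rw [huF]; exact hP0) ⟨g₀, hg₀I, by rw [huF, hwg₀, ← hW₀]; exact hWPQ⟩
  -- ### `k [fx ∪ fx] + [u ∪ w] = 0` (symmetric part) with `[fx ∪ fx] = 0`: contradiction
  have hsymm0 := twoCocycleClass_cupCocycle_add_eq_zero_of_proj_P W K p e hμ hadd₁ hadd₂ halt hgal v hfixA hfixμ k
    (fun z ↦ by rw [← hk]; exact hμ3 z) pr
    (fun a b ↦ by rw [← hW₀]; exact hW₀line (hpr_line a) (hpr_line b))
    (fun a b ↦ by rw [← hW₀]; exact hW₀line (hsub_line a) (hsub_line b)) fx u w hu hw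
  rw [hxx, smul_zero, zero_add] at hsymm0
  exact huw hsymm0


end Summit.BirchSwinnertonDyer.BirchSwinnertonDyer.Theorems.AdditiveKoly

end
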